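import Summits.BirchSwinnertonDyer.BirchSwinnertonDyer.Theses.GenusKolyvaginAtTwo

/-!
# Route `GenusKolyvaginAtTwo`, crux `ExactDescentAtTwo` (stmt-BirchSwinnertonDyer-22138): the rank stub
# `stub_rankZeroAtTwo` IS the `r_an = 0` slice of Gross–Zagier–Kolyvagin (conditional discharge)

Helper for the registered skeleton of crux #4 `ExactDescentAtTwo` (line `birth`, seat
`bsd-line-gk2-p3`: `ExactDescentAtTwo_of` ⟸ `stub_rankZeroAtTwo` + `stub_finiteShaAtTwo` (landed,
`GenusKolyvaginAtTwoExactDescentAtTwoFiniteness.lean`) + `stub_twoAdicValuationAtTwo`). The rank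
stub — for `W/ℚ` globally minimal, non-CM, `ρ_{E,2^∞}` onto, `ord_{s=1} L(E,s) = 0`:
`rank E(ℚ) = 0` — is a theorem in print (Kolyvagin 1989 Thm. A with Gross–Zagier 1986 and an
auxiliary Heegner field, modularity; Darmon 2004 Thm. 3.22) and, in the tree, exactly the `r_an = 0`
case of the NAMED FACT `rank_eq_analyticRank_of_analyticRank_le_one` (bsd.S17, `LeadingTerm.lean`;
not discharged). This file records that reduction in the kernel: `stub_rankZeroAtTwo_of_GZK` proves
the stub's registered signature VERBATIM from the fact taken as a hypothesis `hGZK` — a CONDITIONAL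
result (the stub itself stays open until bsd.S17 is discharged; the non-CM and image hypotheses are
idle, as in print). Nothing is claimed unconditionally. BSD is not proved by any of this.

References: [Darmon2004] Thm. 3.22 (= Thm. 1.14), §3.9; [Kolyvagin1989Izv] Thm. A;
[GrossZagier1986] Thm. I.6.3.
-/

-- D-0017: single-problem summit, so `Summit.BirchSwinnertonDyer.BirchSwinnertonDyer.…` repeats a
-- namespace BY DESIGN.
set_option linter.dupNamespace false

noncomputable section

namespace Summit.BirchSwinnertonDyer.BirchSwinnertonDyer.Theorems

open Literature.NumberTheory.EllipticCurves

/-- **`stub_rankZeroAtTwo` from Gross–Zagier–Kolyvagin.** Granted the tree's named fact bsd.S17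
(`hGZK : rank_eq_analyticRank_of_analyticRank_le_one` — *"if `ord_{s=1} L(E,s) ≤ 1` then
`rank E(ℚ) = ord_{s=1} L(E,s)`"*), the registered rank stub of crux `ExactDescentAtTwo` holds
verbatim: every globally minimal non-CM `W/ℚ` with `ρ_{E,2^n}` onto for all `n ≥ 1` and
`W.analyticRank = 0` has `W.mordellWeilRank = 0`. (The three habitat hypotheses are not used.)
[cite: Darmon2004, Thm. 3.22 (= Thm. 1.14) and §3.9] -/
theorem stub_rankZeroAtTwo_of_GZK (hGZK : rank_eq_analyticRank_of_analyticRank_le_one) :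
    ∀ (W : WeierstrassCurve ℚ) [W.IsElliptic] [W.IsGloballyMinimal],
      ¬ W.HasCM → W.analyticRank = 0 →
      (∀ n : ℕ, 0 < n → W.HasSurjectiveModNGaloisRep ((2 : ℤ) ^ n)) →
      W.mordellWeilRank = 0 := by
  intro W _ _ _ hr0 _
  have h := (hGZK W (hr0.trans_le zero_le_one)).1
  rw [h, hr0]

end Summit.BirchSwinnertonDyer.BirchSwinnertonDyer.Theorems

end
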